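import Summits.Ventures.PercRepro.ProfilePointedCircuitClassesStarNineDefectC

/-!
# PercRepro — THE DEFECT FORM OF (★)₉, PART E: THE CONVERSE DIRECTION
(p5, gen 57; `proofs/P5-GM1.md` §85 ADD 3(a))

`defect_bound_of_starNine`: (★)₉ at `(e, f)` gives `|D_e| ≤ |D_f| + |C|` — the same three bijections as part C read
backwards, so (★)₉ at `(e, f)` and the defect bound are EQUIVALENT (`starNine_iff_defect_bound`).
-/

open scoped Matroid

namespace PercRepro.Cogirth

open Finset ThmH Skew Shadow Profile

open Classical

variable {α : Type} [DecidableEq α] {N : Matroid α} [N.Finite]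

section StarNineDefectE

/-- **THE DEFECT BOUND FROM (★)₉**: `in_4(e) ≤ in_4(f) + thru_4({e, f})` gives `|D_e| ≤ |D_f| + |C|`. -/
theorem defect_bound_of_starNine {e f : α} (hef : e ≠ f)
    (h : inCount N 4 e ≤ inCount N 4 f + thruCount N 4 {e, f}) :
    (defTriples N e f e \ defTriples N e f f).card ≤
      (defTriples N e f f \ defTriples N e f e).card + (cPairs N e f).card := by
  have hXe : ((gr N).erase e).erase f = ((gr N).erase e).erase f := rfl
  have hXf : ((gr N).erase e).erase f = ((gr N).erase f).erase e := erase_right_comm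
  have hGe := card_filter_mem_notMem_eq_card_defTriples (N := N) (e := e) (f := f) hef hXe
  have hGf := card_filter_mem_notMem_eq_card_defTriples (N := N) (e := e) (f := f) hef.symm hXf
  have hC := thruCount_pair_eq_card_cPairs (N := N) hef
  have hDe := card_filter_eq_sum_two (biIndepSets N 4) (fun W => e ∈ W) f
  have hDf := card_filter_eq_sum_two (biIndepSets N 4) (fun W => f ∈ W) e
  have hthru : thruCount N 4 {e, f} = ((biIndepSets N 4).filter (fun W => e ∈ W ∧ f ∈ W)).card := by
    unfold thruCount
    exact congrArg Finset.card (filter_congr (fun W _ => by rw [insert_subset_iff, singleton_subset_iff]))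
  have hcomm : ((biIndepSets N 4).filter (fun W => f ∈ W ∧ e ∈ W)).card =
      ((biIndepSets N 4).filter (fun W => e ∈ W ∧ f ∈ W)).card :=
    congrArg Finset.card (filter_congr (fun W _ => and_comm))
  have hsplit : ∀ A B : Finset (Finset α), A.card = (A \ B).card + (A ∩ B).card := by
    intro A B
    rw [← card_sdiff_add_card_inter A B]
  have hinter : (defTriples N e f f ∩ defTriples N e f e).card = (defTriples N e f e ∩ defTriples N e f f).card := by
    rw [inter_comm]
  unfold inCount at h
  rw [hDe, hDf, hGe, hGf, hthru, hcomm, hsplit (defTriples N e f e) (defTriples N e f f),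
    hsplit (defTriples N e f f) (defTriples N e f e), hinter] at h
  rw [← hC]
  omega

/-- **(★)₉ AT `(e, f)` IS THE DEFECT BOUND**. -/
theorem starNine_iff_defect_bound {e f : α} (hef : e ≠ f) :
    inCount N 4 e ≤ inCount N 4 f + thruCount N 4 {e, f} ↔
      (defTriples N e f e \ defTriples N e f f).card ≤
        (defTriples N e f f \ defTriples N e f e).card + (cPairs N e f).card :=
  ⟨defect_bound_of_starNine hef, starNine_of_defect_bound hef⟩

end StarNineDefectE

end PercRepro.Cogirth
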